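import Summits.QuantumFields.YangMills.Theorems.SlowBitWindowStepPersistenceMinorant
import Summits.QuantumFields.YangMills.Theorems.SwapTwistDeficitSheetTrialEstimates
import HarnessLib

/-!
# The DRESSED sheet witness `(g − g∘S)·e^{−(β/2)S}`: box floor, swap cross term and the polynomial energy `q_β(h,h) ≥ β^{−k} c_β^{|E|}`

Support module for the FIXED-LATTICE rung (BC5 witness «r1 at every fixed `L`») of the crux `SlowBitWindow.StepPersistence` (item stmt-QuantumFields-23271,
D-0145 LINE g10-A of seat ym-idea-4; route onto K2a `ThermalTraceWindow.SubFemtoFirstLevel`).  The ground-state-free spectral floor of the one-step insertion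
trace (`TT.insTrace_one_ge`, module `…StepPersistenceMinorant`) is stated for the DRESSED observable `h = O · e^{−(β/2)S}`; this file supplies the energy of the
dressed sheet witness, `O = g − g∘S` with `g = sheetTrial` (`…SwapTwistDeficitFlatSheetDefs`), `S` the spatial axis swap, `|E| = 3L³`, `|P|` the number of
plaquettes, `c_β^{|E|} = latCE L β`:

* `qform_sheetTrial_dressed_ge_box` ∕ `_ge_poly`: `q_β(g e^{−(β/2)S}, g e^{−(β/2)S}) ≥ e^{−β8r²|P|}·e^{−β8r²|P|}e^{β(2−2r²)|E|}·ballVol(r)^{2|E|}` (`L·r ≤ 1/4`),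
  hence `≥ e^{−(16|P|+2|E|)} (5⁸(8β+1)¹⁹)^{−2|E|} e^{2β|E|}` at `r = 1/√β`, `β ≥ max(1,16L²)` — on the box around the flat sheet configuration `g = 1`, the
  magnetic weight is `≥ e^{−(β/2)8r²|P|}` and the kernel floor of `…FlatSheetBox` holds;
* `qform_sheetTrial_dressed_cross_le`: `q_β(g e^{−(β/2)S}, (g∘S) e^{−(β/2)S}) ≤ e^{β(2|E| − 1/(2L²))}` (supports one far link apart, dressed values in `[0,1]`);
* ★ `sheetTrial_dressed_gap`: `∃ k β₁, ∀ β ≥ β₁, β^{−k} c_β^{|E|} ≤ q_β(h,h)` (`k = 38|E|+1`; `q_β(h,h) = q_β(gw,gw) − 2q_β(gw,(g∘S)w) + q_β((g∘S)w,(g∘S)w)` and the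
  last term is `≥ 0`).

HONEST FRAMING: crude fixed-lattice Laplace bookkeeping (constants astronomically non-optimal); a BC5 witness for a DRAFT line onto a RECORD rung; no RG content;
nothing about infinite volume, the continuum limit or the Clay gap.  No `sorry`, no new axiom, no new definition.
References: [cite: ReedSimonIV1978, Thm. XIII.1]; [cite: Luscher1983, §2]; [cite: SeilerLNP1982, §3].
-/

set_option autoImplicit false

noncomputable section

open MeasureTheory Filter Topology Real Function
open scoped Matrix ComplexConjugate BigOperators
open Literature.MathematicalPhysics.QuantumLattice
open Literature.MathematicalPhysics.QuantumFieldTheory hiding SU2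
open Summit.QuantumFields.YangMills.Theorems

namespace Summit.QuantumFields.YangMills.Theorems.FemtoTransferGap.FlatSheet

open Summit.QuantumFields.YangMills.Theorems.FemtoTransferGap

variable {L : ℕ} [NeZero L]

/-! ## §1 The dressed sheet trial function `g · e^{−(β/2)S}`: box floor, swap cross term, polynomial gap -/

/-- The dressed trial function `g·e^{−(β/2)S}` is physical. [folklore] -/
theorem isPhys_sheetTrial_dressed (β : ℝ) :
    IsPhys (fun U : GaugeConfig 3 L SU2 => sheetTrial U * Real.exp (-(β / 2) * wilsonAction su2Rep U)) :=
  isPhys_mul_expAction β isPhys_sheetTrial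

/-- The swapped dressed trial function `(g∘S)·e^{−(β/2)S}` is physical. [folklore] -/
theorem isPhys_sheetTrial_swap_dressed (β : ℝ) :
    IsPhys (fun U : GaugeConfig 3 L SU2 => sheetTrial (configPerm (Equiv.swap (0 : Fin 3) 1) U) * Real.exp (-(β / 2) * wilsonAction su2Rep U)) :=
  isPhys_mul_expAction β (isPhys_sheetTrial.comp_configPerm (Equiv.swap (0 : Fin 3) 1))

/-- `|g·e^{−(β/2)S}| ≤ 1` (`β ≥ 0`). [folklore] -/
theorem abs_sheetTrial_dressed_le_one {β : ℝ} (hβ : 0 ≤ β) (U : GaugeConfig 3 L SU2) :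
    |sheetTrial U * Real.exp (-(β / 2) * wilsonAction su2Rep U)| ≤ 1 := by
  rw [abs_mul, abs_of_pos (Real.exp_pos _)]
  exact mul_le_one₀ (abs_sheetTrial_le_one U) (Real.exp_pos _).le (expAction_le_one hβ U)

/-- `|(g∘S)·e^{−(β/2)S}| ≤ 1` (`β ≥ 0`). [folklore] -/
theorem abs_sheetTrial_swap_dressed_le_one {β : ℝ} (hβ : 0 ≤ β) (U : GaugeConfig 3 L SU2) :
    |sheetTrial (configPerm (Equiv.swap (0 : Fin 3) 1) U) * Real.exp (-(β / 2) * wilsonAction su2Rep U)| ≤ 1 := by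
  rw [abs_mul, abs_of_pos (Real.exp_pos _)]
  exact mul_le_one₀ (abs_sheetTrial_le_one _) (Real.exp_pos _).le (expAction_le_one hβ U)

/-- On the box `A_r(sheetCfg L)` the magnetic weight is `≥ e^{−(β/2)·8r²|P|}` (`β ≥ 0`). [folklore] -/
theorem expAction_ge_of_near_sheet {β : ℝ} (hβ : 0 ≤ β) {r : ℝ} {U : GaugeConfig 3 L SU2}
    (hU : ∀ e, frobNorm ((U e : Matrix (Fin 2) (Fin 2) ℂ) - (sheetCfg L e : Matrix (Fin 2) (Fin 2) ℂ)) ≤ r) :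
    Real.exp (-(β / 2 * (8 * r ^ 2 * Fintype.card (Plaquette 3 L)))) ≤ Real.exp (-(β / 2) * wilsonAction su2Rep U) := by
  have hS := wilsonAction_le_of_near_flat U (sheetCfg L) (plaquetteHolonomy_sheetCfg (L := L)) hU
  exact Real.exp_le_exp.2 (by nlinarith)

/-- **Box floor of the dressed diagonal energy**: for `L·r ≤ 1/4`, `β ≥ 0`,
`q_β(g e^{−(β/2)S}, g e^{−(β/2)S}) ≥ e^{−β·8r²|P|} · (e^{−β·8r²|P|} e^{β(2−2r²)|E|}) · ballVol(r)^{2|E|}` (restrict to `A_r(sheetCfg L)²`, where `g = 1`,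
`S ≤ 8r²|P|` and the kernel floor `transferKernel_ge_of_near_sheet` holds). [cite: SeilerLNP1982, §3] -/
theorem qform_sheetTrial_dressed_ge_box {β : ℝ} (hβ : 0 ≤ β) {r : ℝ} (hLr : (L : ℝ) * r ≤ 1 / 4) :
    Real.exp (-(β * (8 * r ^ 2 * Fintype.card (Plaquette 3 L)))) *
        (Real.exp (-(β * (8 * r ^ 2 * Fintype.card (Plaquette 3 L)))) * Real.exp (β * (2 - 2 * r ^ 2)) ^ Fintype.card (Edge 3 L)) *
        ballVol r ^ (2 * Fintype.card (Edge 3 L)) ≤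
      qform su2Rep β (fun U : GaugeConfig 3 L SU2 => sheetTrial U * Real.exp (-(β / 2) * wilsonAction su2Rep U))
        (fun U => sheetTrial U * Real.exp (-(β / 2) * wilsonAction su2Rep U)) := by
  set A : Set (GaugeConfig 3 L SU2) :=
    {U | ∀ e, frobNorm ((U e : Matrix (Fin 2) (Fin 2) ℂ) - (sheetCfg L e : Matrix (Fin 2) (Fin 2) ℂ)) ≤ r} with hA
  have hAm : MeasurableSet A := measurableSet_box (sheetCfg L) r
  set gw : GaugeConfig 3 L SU2 → ℝ := fun U => sheetTrial U * Real.exp (-(β / 2) * wilsonAction su2Rep U) with hgw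
  have hgwP : IsPhys gw := isPhys_sheetTrial_dressed β
  set m : ℝ := Real.exp (-(β * (8 * r ^ 2 * Fintype.card (Plaquette 3 L)))) *
    (Real.exp (-(β * (8 * r ^ 2 * Fintype.card (Plaquette 3 L)))) * Real.exp (β * (2 - 2 * r ^ 2)) ^ Fintype.card (Edge 3 L)) with hm
  have hprod : qform su2Rep β gw gw = ∫ p, gw p.1 * transferKernel su2Rep β p.1 p.2 * gw p.2 ∂(configMeasure SU2 L).prod (configMeasure SU2 L) :=
    qform_eq_integral_latProd hβ hgwP
  have hF : Integrable (fun p : GaugeConfig 3 L SU2 × GaugeConfig 3 L SU2 => gw p.1 * transferKernel su2Rep β p.1 p.2 * gw p.2)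
      ((configMeasure SU2 L).prod (configMeasure SU2 L)) :=
    integrable_latSandwich (measurable_transferKernel_lat β) (abs_transferKernel_le_lat hβ) hgwP.measurable hgwP.measurable
      (abs_sheetTrial_dressed_le_one hβ) (abs_sheetTrial_dressed_le_one hβ)
  have hAA : MeasurableSet (A ×ˢ A) := hAm.prod hAm
  have hind : ∫ p, (A ×ˢ A).indicator (fun _ => m) p ∂(configMeasure SU2 L).prod (configMeasure SU2 L) =
      m * ((configMeasure SU2 L).real A) ^ 2 := by
    rw [integral_indicator_const _ hAA, smul_eq_mul, Measure.real, Measure.prod_prod, ENNReal.toReal_mul]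
    rw [← Measure.real]; ring
  have hle : ∫ p, (A ×ˢ A).indicator (fun _ => m) p ∂(configMeasure SU2 L).prod (configMeasure SU2 L) ≤
      ∫ p, gw p.1 * transferKernel su2Rep β p.1 p.2 * gw p.2 ∂(configMeasure SU2 L).prod (configMeasure SU2 L) := by
    refine integral_mono ((integrable_const m).indicator hAA) hF fun p => ?_
    by_cases hp : p ∈ A ×ˢ A
    · rw [Set.indicator_of_mem hp]
      obtain ⟨hU, hV⟩ := Set.mem_prod.1 hp
      have hwU := expAction_ge_of_near_sheet (L := L) hβ hU
      have hwV := expAction_ge_of_near_sheet (L := L) hβ hV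
      have hK := transferKernel_ge_of_near_sheet hβ hU hV
      simp only [hgw]
      rw [sheetTrial_eq_one_of_near_sheet hLr hU, sheetTrial_eq_one_of_near_sheet hLr hV, one_mul, one_mul]
      have hww : Real.exp (-(β * (8 * r ^ 2 * Fintype.card (Plaquette 3 L)))) ≤
          Real.exp (-(β / 2) * wilsonAction su2Rep p.1) * Real.exp (-(β / 2) * wilsonAction su2Rep p.2) := by
        have e2 : Real.exp (-(β * (8 * r ^ 2 * Fintype.card (Plaquette 3 L)))) =
            Real.exp (-(β / 2 * (8 * r ^ 2 * Fintype.card (Plaquette 3 L)))) * Real.exp (-(β / 2 * (8 * r ^ 2 * Fintype.card (Plaquette 3 L)))) := by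
          rw [← Real.exp_add]; congr 1; ring
        rw [e2]
        exact mul_le_mul hwU hwV (Real.exp_pos _).le (Real.exp_pos _).le
      calc m = Real.exp (-(β * (8 * r ^ 2 * Fintype.card (Plaquette 3 L)))) *
            (Real.exp (-(β * (8 * r ^ 2 * Fintype.card (Plaquette 3 L)))) * Real.exp (β * (2 - 2 * r ^ 2)) ^ Fintype.card (Edge 3 L)) := hm
        _ ≤ (Real.exp (-(β / 2) * wilsonAction su2Rep p.1) * Real.exp (-(β / 2) * wilsonAction su2Rep p.2)) * transferKernel su2Rep β p.1 p.2 :=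
            mul_le_mul hww hK (by positivity) (by positivity)
        _ = Real.exp (-(β / 2) * wilsonAction su2Rep p.1) * transferKernel su2Rep β p.1 p.2 * Real.exp (-(β / 2) * wilsonAction su2Rep p.2) := by
            ring
    · rw [Set.indicator_of_notMem hp]
      have := transferKernel_pos su2Rep β p.1 p.2
      have := sheetTrial_nonneg p.1
      have := sheetTrial_nonneg p.2
      have := Real.exp_pos (-(β / 2) * wilsonAction su2Rep p.1)
      have := Real.exp_pos (-(β / 2) * wilsonAction su2Rep p.2)
      simp only [hgw]
      positivity
  rw [hind, hA, configMeasure_real_box, ← pow_mul, mul_comm (Fintype.card (Edge 3 L)) 2] at hle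
  rw [hprod]
  exact hle

/-- **Polynomial floor of the dressed diagonal energy**: for `β ≥ max(1, 16L²)` (radius `r = 1/√β`),
`q_β(g e^{−(β/2)S}, g e^{−(β/2)S}) ≥ e^{−(16|P|+2|E|)} · (5⁸(8β+1)¹⁹)^{−2|E|} · (e^{2β})^{|E|}`. [cite: Luscher1983, §2] -/
theorem qform_sheetTrial_dressed_ge_poly {β : ℝ} (hβ1 : 1 ≤ β) (hβL : 16 * (L : ℝ) ^ 2 ≤ β) :
    Real.exp (-(16 * (Fintype.card (Plaquette 3 L) : ℝ) + 2 * Fintype.card (Edge 3 L))) *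
        (((5 : ℝ) ^ 8 * (8 * β + 1) ^ 19)⁻¹) ^ (2 * Fintype.card (Edge 3 L)) * Real.exp (2 * β) ^ Fintype.card (Edge 3 L) ≤
      qform su2Rep β (fun U : GaugeConfig 3 L SU2 => sheetTrial U * Real.exp (-(β / 2) * wilsonAction su2Rep U))
        (fun U => sheetTrial U * Real.exp (-(β / 2) * wilsonAction su2Rep U)) := by
  have hβ0 : 0 < β := by linarith
  have hsβ : 0 < Real.sqrt β := Real.sqrt_pos.2 hβ0
  have hL : (0 : ℝ) < L := Nat.cast_pos.2 (Nat.pos_of_ne_zero (NeZero.ne L))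
  have hLr : (L : ℝ) * (1 / Real.sqrt β) ≤ 1 / 4 := by
    rw [mul_one_div, div_le_iff₀ hsβ]
    have h4 : 4 * (L : ℝ) ≤ Real.sqrt β := by
      have hsq : (4 * (L : ℝ)) ^ 2 ≤ β := by nlinarith
      have h := Real.sqrt_le_sqrt hsq
      rwa [Real.sqrt_sq (by positivity)] at h
    linarith
  have hbox := qform_sheetTrial_dressed_ge_box (L := L) hβ0.le hLr
  have hr2 : β * (1 / Real.sqrt β) ^ 2 = 1 := by
    rw [div_pow, one_pow, Real.sq_sqrt hβ0.le]; field_simp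
  set P : ℕ := Fintype.card (Plaquette 3 L) with hP
  set E : ℕ := Fintype.card (Edge 3 L) with hE
  have e1 : Real.exp (-(β * (8 * (1 / Real.sqrt β) ^ 2 * P))) *
      (Real.exp (-(β * (8 * (1 / Real.sqrt β) ^ 2 * P))) * Real.exp (β * (2 - 2 * (1 / Real.sqrt β) ^ 2)) ^ E) =
      Real.exp (-(16 * (P : ℝ) + 2 * E)) * Real.exp (2 * β) ^ E := by
    have a1 : -(β * (8 * (1 / Real.sqrt β) ^ 2 * P)) = -(8 * (P : ℝ)) := by
      have : β * (8 * (1 / Real.sqrt β) ^ 2 * P) = 8 * (β * (1 / Real.sqrt β) ^ 2) * P := by ring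
      rw [this, hr2, mul_one]
    have a2 : β * (2 - 2 * (1 / Real.sqrt β) ^ 2) = 2 * β + -(2 : ℝ) := by
      have : β * (2 - 2 * (1 / Real.sqrt β) ^ 2) = 2 * β - 2 * (β * (1 / Real.sqrt β) ^ 2) := by ring
      rw [this, hr2]; ring
    rw [a1, a2, Real.exp_add, mul_pow, ← Real.exp_nat_mul (-(2 : ℝ)) E,
      show -(16 * (P : ℝ) + 2 * E) = -(8 * (P : ℝ)) + (-(8 * (P : ℝ)) + (E : ℕ) * (-2 : ℝ)) by ring, Real.exp_add, Real.exp_add]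
    ring
  rw [e1] at hbox
  have hball : (((5 : ℝ) ^ 8 * (8 * β + 1) ^ 19)⁻¹) ^ (2 * E) ≤ ballVol (1 / Real.sqrt β) ^ (2 * E) :=
    pow_le_pow_left₀ (by positivity) (ballVol_inv_sqrt_ge hβ1) _
  refine le_trans ?_ hbox
  have h0 : 0 ≤ Real.exp (-(16 * (P : ℝ) + 2 * E)) * Real.exp (2 * β) ^ E := by positivity
  calc Real.exp (-(16 * (P : ℝ) + 2 * E)) * (((5 : ℝ) ^ 8 * (8 * β + 1) ^ 19)⁻¹) ^ (2 * E) * Real.exp (2 * β) ^ E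
      = (Real.exp (-(16 * (P : ℝ) + 2 * E)) * Real.exp (2 * β) ^ E) * (((5 : ℝ) ^ 8 * (8 * β + 1) ^ 19)⁻¹) ^ (2 * E) := by ring
    _ ≤ (Real.exp (-(16 * (P : ℝ) + 2 * E)) * Real.exp (2 * β) ^ E) * ballVol (1 / Real.sqrt β) ^ (2 * E) :=
        mul_le_mul_of_nonneg_left hball h0
    _ = _ := by ring

/-- **Dressed swap cross term**: `q_β(g e^{−(β/2)S}, (g∘S) e^{−(β/2)S}) ≤ e^{β(2|E| − 1/(2L²))}` (`β ≥ 0`): the supports of `g` and `g∘S` are one far link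
apart (`transferKernel_le_of_supports`) and the dressed functions take values in `[0,1]`. [cite: SeilerLNP1982, §3] -/
theorem qform_sheetTrial_dressed_cross_le {β : ℝ} (hβ : 0 ≤ β) :
    qform su2Rep β (fun U : GaugeConfig 3 L SU2 => sheetTrial U * Real.exp (-(β / 2) * wilsonAction su2Rep U))
        (fun U => sheetTrial (configPerm (Equiv.swap (0 : Fin 3) 1) U) * Real.exp (-(β / 2) * wilsonAction su2Rep U)) ≤
      Real.exp (β * (2 * (Fintype.card (Edge 3 L) : ℝ) - (1 / (L : ℝ)) ^ 2 / 2)) := by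
  set B : ℝ := Real.exp (β * (2 * (Fintype.card (Edge 3 L) : ℝ) - (1 / (L : ℝ)) ^ 2 / 2)) with hB
  have hB0 : 0 ≤ B := (Real.exp_pos _).le
  set gw : GaugeConfig 3 L SU2 → ℝ := fun U => sheetTrial U * Real.exp (-(β / 2) * wilsonAction su2Rep U) with hgw
  set gSw : GaugeConfig 3 L SU2 → ℝ := fun U => sheetTrial (configPerm (Equiv.swap (0 : Fin 3) 1) U) * Real.exp (-(β / 2) * wilsonAction su2Rep U)
    with hgSw
  have hgwP : IsPhys gw := isPhys_sheetTrial_dressed β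
  have hgSwP : IsPhys gSw := isPhys_sheetTrial_swap_dressed β
  have hF := integrable_latSandwich (measurable_transferKernel_lat β) (abs_transferKernel_le_lat hβ) hgwP.measurable hgSwP.measurable
      (abs_sheetTrial_dressed_le_one hβ) (abs_sheetTrial_swap_dressed_le_one hβ)
  have hprod : qform su2Rep β gw gSw = ∫ p, gw p.1 * transferKernel su2Rep β p.1 p.2 * gSw p.2 ∂(configMeasure SU2 L).prod (configMeasure SU2 L) :=
    (integral_prod _ hF).symm
  rw [hprod]
  have hw1 : ∀ U : GaugeConfig 3 L SU2, Real.exp (-(β / 2) * wilsonAction su2Rep U) ≤ 1 := expAction_le_one hβ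
  have hpt : ∀ p : GaugeConfig 3 L SU2 × GaugeConfig 3 L SU2, gw p.1 * transferKernel su2Rep β p.1 p.2 * gSw p.2 ≤ B := by
    intro p
    by_cases h1 : sheetTrial p.1 = 0
    · simp only [hgw, hgSw]; rw [h1, zero_mul, zero_mul, zero_mul]; exact hB0
    by_cases h2 : sheetTrial (configPerm (Equiv.swap (0 : Fin 3) 1) p.2) = 0
    · simp only [hgw, hgSw]; rw [h2, zero_mul, mul_zero]; exact hB0
    have hK := transferKernel_le_of_supports hβ h1 h2
    have hg1 : gw p.1 ≤ 1 := by
      simp only [hgw]; exact mul_le_one₀ (sheetTrial_le_one _) (Real.exp_pos _).le (hw1 _)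
    have hg2 : gSw p.2 ≤ 1 := by
      simp only [hgSw]; exact mul_le_one₀ (sheetTrial_le_one _) (Real.exp_pos _).le (hw1 _)
    have hg10 : 0 ≤ gw p.1 := by simp only [hgw]; exact mul_nonneg (sheetTrial_nonneg _) (Real.exp_pos _).le
    have hg20 : 0 ≤ gSw p.2 := by simp only [hgSw]; exact mul_nonneg (sheetTrial_nonneg _) (Real.exp_pos _).le
    calc gw p.1 * transferKernel su2Rep β p.1 p.2 * gSw p.2
        ≤ 1 * B * 1 := mul_le_mul (mul_le_mul hg1 hK (transferKernel_pos _ _ _ _).le zero_le_one) hg2 hg20 (by positivity)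
      _ = B := by ring
  calc ∫ p, gw p.1 * transferKernel su2Rep β p.1 p.2 * gSw p.2 ∂(configMeasure SU2 L).prod (configMeasure SU2 L)
      ≤ ∫ _p, B ∂(configMeasure SU2 L).prod (configMeasure SU2 L) := integral_mono hF (integrable_const B) hpt
    _ = B := by rw [integral_const, smul_eq_mul, probReal_univ, one_mul]

variable (L) in
/-- ★ **Polynomial energy of the dressed odd witness.**  For every `L ≥ 1` there are `k` (`= 38|E| + 1`) and `β₁` such that for all `β ≥ β₁`, with
`O = g − g∘S` (`g = sheetTrial`) and `h = O · e^{−(β/2)S}`:  `β^{−k} · c_β^{|E|} ≤ q_β(h, h)`.  (`q_β(h,h) ≥ q_β(gw,gw) − 2 q_β(gw,(g∘S)w)`: the diagonal is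
within a polynomial factor of the free row sum, the cross term is exponentially smaller.) [cite: ReedSimonIV1978, Thm. XIII.1] [cite: Luscher1983, §2] -/
theorem sheetTrial_dressed_gap : ∃ k β₁ : ℝ, 1 ≤ β₁ ∧ ∀ β : ℝ, β₁ ≤ β →
    β ^ (-k) * latCE L β ≤ qform su2Rep β
      (fun U : GaugeConfig 3 L SU2 => (sheetTrial U - sheetTrial (configPerm (Equiv.swap (0 : Fin 3) 1) U)) * Real.exp (-(β / 2) * wilsonAction su2Rep U))
      (fun U => (sheetTrial U - sheetTrial (configPerm (Equiv.swap (0 : Fin 3) 1) U)) * Real.exp (-(β / 2) * wilsonAction su2Rep U)) := by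
  set E : ℕ := Fintype.card (Edge 3 L) with hE
  set P : ℕ := Fintype.card (Plaquette 3 L) with hP
  have hL : (0 : ℝ) < L := Nat.cast_pos.2 (Nat.pos_of_ne_zero (NeZero.ne L))
  -- the constant `c₁ = ⅓ e^{−(16P+2E)} (5⁸ 9¹⁹)^{−2E}` of the polynomial floor `c₁ β^{−38E}`
  set c₁ : ℝ := (1 / 3) * Real.exp (-(16 * (P : ℝ) + 2 * E)) * (((5 : ℝ) ^ 8 * 9 ^ 19)⁻¹) ^ (2 * E) with hc₁
  have hc₁pos : 0 < c₁ := by positivity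
  obtain ⟨β₂, hβ₂1, hβ₂⟩ := exists_mul_pow_le_exp (1 / c₁) (38 * E) (b := (1 / (L : ℝ)) ^ 2 / 2) (by positivity)
  refine ⟨((38 * E + 1 : ℕ) : ℝ), max (max (16 * (L : ℝ) ^ 2) β₂) (1 / c₁), le_trans hβ₂1 ((le_max_right _ _).trans (le_max_left _ _)),
    fun β hβ => ?_⟩
  have hβL : 16 * (L : ℝ) ^ 2 ≤ β := (le_max_left _ _).trans ((le_max_left _ _).trans hβ)
  have hββ₂ : β₂ ≤ β := (le_max_right _ _).trans ((le_max_left _ _).trans hβ)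
  have hβc : 1 / c₁ ≤ β := (le_max_right _ _).trans hβ
  have hβ1 : 1 ≤ β := hβ₂1.trans hββ₂
  have hβ0 : 0 < β := by linarith
  -- the three dressed functions
  set S := configPerm (G := SU2) (L := L) (Equiv.swap (0 : Fin 3) 1) with hS
  set gw : GaugeConfig 3 L SU2 → ℝ := fun U => sheetTrial U * Real.exp (-(β / 2) * wilsonAction su2Rep U) with hgw
  set gSw : GaugeConfig 3 L SU2 → ℝ := fun U => sheetTrial (S U) * Real.exp (-(β / 2) * wilsonAction su2Rep U) with hgSw
  have hgwP : IsPhys gw := isPhys_sheetTrial_dressed β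
  have hgSwP : IsPhys gSw := isPhys_sheetTrial_swap_dressed β
  have hh_eq : (fun U : GaugeConfig 3 L SU2 => (sheetTrial U - sheetTrial (S U)) * Real.exp (-(β / 2) * wilsonAction su2Rep U)) =
      gw + (-1 : ℝ) • gSw := by
    funext U; simp only [hgw, hgSw, Pi.add_apply, Pi.smul_apply, smul_eq_mul]; ring
  have hhP : IsPhys (gw + (-1 : ℝ) • gSw) := hgwP.add (hgSwP.smul (-1))
  set Q : ℝ := qform su2Rep β gw gw with hQ
  set X : ℝ := qform su2Rep β gw gSw with hX
  have hXS : qform su2Rep β gSw gw = X := by rw [qform_su2Rep_comm β hgSwP hgwP]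
  have hQS : 0 ≤ qform su2Rep β gSw gSw := qform_su2Rep_self_nonneg hβ0.le hgSwP
  have hexp : qform su2Rep β (gw + (-1 : ℝ) • gSw) (gw + (-1 : ℝ) • gSw) = Q - 2 * X + qform su2Rep β gSw gSw := by
    rw [qform_add_left β hgwP (hgSwP.smul (-1)) hhP, qform_smul_left, qform_su2Rep_comm β hgwP hhP, qform_su2Rep_comm β hgSwP hhP,
      qform_add_left β hgwP (hgSwP.smul (-1)) hgwP, qform_add_left β hgwP (hgSwP.smul (-1)) hgSwP, qform_smul_left, qform_smul_left, hXS,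
      ← hQ, ← hX]
    ring
  rw [hh_eq, hexp]
  -- the floor: `(5⁸(8β+1)¹⁹)⁻¹ ≥ (5⁸ 9¹⁹)⁻¹ β⁻¹⁹` for `β ≥ 1`
  have hV : ((5 : ℝ) ^ 8 * 9 ^ 19)⁻¹ * (β ^ 19)⁻¹ ≤ ((5 : ℝ) ^ 8 * (8 * β + 1) ^ 19)⁻¹ := by
    rw [← mul_inv]
    refine inv_anti₀ (by positivity) ?_
    rw [mul_assoc, ← mul_pow]
    exact mul_le_mul_of_nonneg_left (pow_le_pow_left₀ (by positivity) (by linarith) 19) (by positivity)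
  have hV0 : 0 ≤ ((5 : ℝ) ^ 8 * 9 ^ 19)⁻¹ * (β ^ 19)⁻¹ := by positivity
  have hVpow : (((5 : ℝ) ^ 8 * 9 ^ 19)⁻¹) ^ (2 * E) * (β ^ (38 * E))⁻¹ ≤ (((5 : ℝ) ^ 8 * (8 * β + 1) ^ 19)⁻¹) ^ (2 * E) := by
    have h := pow_le_pow_left₀ hV0 hV (2 * E)
    rw [mul_pow, ← inv_pow, ← pow_mul, show 19 * (2 * E) = 38 * E by ring, inv_pow β] at h
    exact h
  have hQfloor := qform_sheetTrial_dressed_ge_poly (L := L) hβ1 hβL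
  have hfloor : 3 * c₁ * (β ^ (38 * E))⁻¹ * Real.exp (2 * β) ^ E ≤
      Real.exp (-(16 * (P : ℝ) + 2 * E)) * (((5 : ℝ) ^ 8 * (8 * β + 1) ^ 19)⁻¹) ^ (2 * E) * Real.exp (2 * β) ^ E := by
    refine mul_le_mul_of_nonneg_right ?_ (by positivity)
    have : 3 * c₁ * (β ^ (38 * E))⁻¹ = Real.exp (-(16 * (P : ℝ) + 2 * E)) * ((((5 : ℝ) ^ 8 * 9 ^ 19)⁻¹) ^ (2 * E) * (β ^ (38 * E))⁻¹) := by
      rw [hc₁]; ring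
    rw [this]
    exact mul_le_mul_of_nonneg_left hVpow (Real.exp_pos _).le
  -- the cross term: `X ≤ e^{2βE} e^{-β/(2L²)} ≤ c₁ β^{-38E} e^{2βE}`
  have hXle := qform_sheetTrial_dressed_cross_le (L := L) hβ0.le
  have hsep : Real.exp (β * (2 * (E : ℝ) - (1 / (L : ℝ)) ^ 2 / 2)) ≤ c₁ * (β ^ (38 * E))⁻¹ * Real.exp (2 * β) ^ E := by
    have h := hβ₂ β hββ₂
    have hsplit : Real.exp (β * (2 * (E : ℝ) - (1 / (L : ℝ)) ^ 2 / 2)) =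
        Real.exp (2 * β) ^ E * (Real.exp ((1 / (L : ℝ)) ^ 2 / 2 * β))⁻¹ := by
      rw [← Real.exp_nat_mul, ← Real.exp_neg, ← Real.exp_add]; congr 1; ring
    rw [hsplit]
    have hβpow : 0 < β ^ (38 * E) := pow_pos hβ0 _
    have hexp : (Real.exp ((1 / (L : ℝ)) ^ 2 / 2 * β))⁻¹ ≤ c₁ * (β ^ (38 * E))⁻¹ := by
      rw [← one_div, div_le_iff₀ (Real.exp_pos _), mul_assoc]
      have h' : 1 / c₁ * β ^ (38 * E) * (c₁ * (β ^ (38 * E))⁻¹) = 1 := by field_simp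
      calc (1 : ℝ) = 1 / c₁ * β ^ (38 * E) * (c₁ * (β ^ (38 * E))⁻¹) := h'.symm
        _ ≤ Real.exp ((1 / (L : ℝ)) ^ 2 / 2 * β) * (c₁ * (β ^ (38 * E))⁻¹) := mul_le_mul_of_nonneg_right h (by positivity)
        _ = c₁ * ((β ^ (38 * E))⁻¹ * Real.exp ((1 / (L : ℝ)) ^ 2 / 2 * β)) := by ring
    calc Real.exp (2 * β) ^ E * (Real.exp ((1 / (L : ℝ)) ^ 2 / 2 * β))⁻¹
        ≤ Real.exp (2 * β) ^ E * (c₁ * (β ^ (38 * E))⁻¹) := mul_le_mul_of_nonneg_left hexp (by positivity)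
      _ = c₁ * (β ^ (38 * E))⁻¹ * Real.exp (2 * β) ^ E := by ring
  -- `β^{-(38E+1)} latCE ≤ c₁ β^{-38E} e^{2βE}`
  have hlat : β ^ (-(((38 * E + 1 : ℕ) : ℝ))) * latCE L β ≤ c₁ * (β ^ (38 * E))⁻¹ * Real.exp (2 * β) ^ E := by
    rw [Real.rpow_neg hβ0.le, Real.rpow_natCast, pow_succ, mul_inv]
    have hCE := latCE_le (L := L) hβ0.le
    have hβinv : β⁻¹ ≤ c₁ := by
      rw [inv_le_comm₀ hβ0 hc₁pos, ← one_div]; exact hβc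
    calc (β ^ (38 * E))⁻¹ * β⁻¹ * latCE L β ≤ (β ^ (38 * E))⁻¹ * c₁ * Real.exp (2 * β) ^ E :=
          mul_le_mul (mul_le_mul_of_nonneg_left hβinv (by positivity)) hCE (latCE_pos hβ0.le).le (by positivity)
      _ = c₁ * (β ^ (38 * E))⁻¹ * Real.exp (2 * β) ^ E := by ring
  -- assemble
  have hXS' : X ≤ c₁ * (β ^ (38 * E))⁻¹ * Real.exp (2 * β) ^ E := hXle.trans hsep
  have hQ' : 3 * c₁ * (β ^ (38 * E))⁻¹ * Real.exp (2 * β) ^ E ≤ Q := hfloor.trans hQfloor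
  calc β ^ (-(((38 * E + 1 : ℕ) : ℝ))) * latCE L β ≤ c₁ * (β ^ (38 * E))⁻¹ * Real.exp (2 * β) ^ E := hlat
    _ = 3 * c₁ * (β ^ (38 * E))⁻¹ * Real.exp (2 * β) ^ E - 2 * (c₁ * (β ^ (38 * E))⁻¹ * Real.exp (2 * β) ^ E) + 0 := by ring
    _ ≤ Q - 2 * X + qform su2Rep β gSw gSw := by linarith

end Summit.QuantumFields.YangMills.Theorems.FemtoTransferGap.FlatSheet

end
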